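import Literature.AlgebraicGeometry.AbelianSchemes.SerreTensorIdealTranslationBaseChange
import Literature.AlgebraicGeometry.AbelianSchemes.SerreTensorIdealTranslationKernelScheme
import Literature.AlgebraicGeometry.GroupSchemes.GroupSchemeKernelBaseChange
import HarnessLib

/-!
# The `𝔭`-torsion layer `A[𝔭] ↪ A` of an abelian scheme with an `𝒪`-action: a finite flat closed subgroup scheme with the kernel-of-`𝔭`
# universal property on ALL points, over ANY base, stable under base change and unique ([Conrad2004GrossZagier] §7 Thm. 7.5; [MilneCM2006] §7)

Topic `Literature/AlgebraicGeometry/AbelianSchemes`; namespace `Literature.AlgebraicGeometry.AbelianSchemes.AbelianSchemeOver.IdealTorsion`.  THEOREMS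
ONLY (no definition, no instance, no notation, no named fact, no `sorry`): everything is stated about the ★ kernel object
`GroupSchemeKernel.ker (serreTranslate act E′ hE′ P)` of the ★ ideal translation `ψ_P : A ⟶ A ⊗_𝒪 𝔟` (`SerreTensorIdealTranslationKernel`).  Cell
`hodgecm-mathlib` (D-0151), programme P6 «MOD» (crux hLiu418 = stmt-HodgeConjecture-24832, `--supports`, count-neutral): organ **(S-c) «THE `𝔭`-TORSION
LAYER OF AN ABELIAN SCHEME»** for the D-line `Lines/F0_P6a_DatumOfInputs.lean` socket `stub_SPEC` (desk F0P6c-plan (g4) 2026-09-02T01:36:14Z; LEAD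
F0P6-plan (g3) 01:38:39Z): the SOURCE of `sp y L` — the finite flat `R`-group `𝒢 = A[𝔭_(c•w)]` over the valuation ring `𝒪_Ω̄` whose generic fibre carries
the lines `H_L ⊂ A_y[𝔭](Ω)` and whose special fibre IS the dock՚s `G₀ x̄` — on which ★ `spI` (`AdmissibleIdealSpecialFibre`), ★ (E-b4′)
`CanonicalLineAssembly`, ★ (O-K) `KernelIdealSpecialFibre` and ★ SP-SURJ `AdmissibleIdealSpecialFibreSurjective` are stated.  The desk՚s letter asked for a
flat closure with the clause «on flat points»; the kernel realisation below is STRONGER: scheme-theoretic, the clause holds for ALL `T`, over ANY base `S`.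
HC_CM is proved only modulo the printed citations until rung 0 closes; this file is generic and changes no count.

THE PRINT.  [Conrad2004GrossZagier] §7 Thm. 7.5 ∕ [MilneCM2006] §7 «𝔞-multiplications»: for an abelian scheme `A∕S` with `𝒪 → End(A)` and an
invertible ideal `𝔭`, the ideal translation `ψ : A → A ⊗_𝒪 𝔭⁻¹` is an isogeny with kernel `A[𝔭] = ⋂_{a ∈ 𝔭} Ker ι(a)`; hence `A[𝔭]` is a finite flat
closed subgroup scheme, `A[𝔭](T) = {t ∈ A(T) : ι(a)t = 1 ∀ a ∈ 𝔭}` for every `T`, and everything commutes with base change.  PRESENTATION (as in ★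
`SerreTensorIdealTranslationKernel` §3, hypotheses here): `𝔟 = E′·𝒪ᵐ` (`E′² = E′`), a column `P` with `E′P = P` whose entries generate `𝔭`, and a quasi-inverse row
`Q` (`QE′ = Q`, `QP = N·1`, `PQ = N·E′`, `N ≠ 0`) — for a Dedekind `𝔭`: `𝔟 ≅ 𝔭⁻¹`, `P ↔ 1 ∈ 𝔭⁻¹`, `N ∈ 𝔭 ∩ ℕ`.

## Contents (`𝒢 := ker (serreTranslate act E′ hE′ P)`, `ι := kerι _`, ★ instances `grpObjKer`, `isMonHom_kerι`, `mono_kerι`)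
* §1 `isClosedImmersion_kerι_serreTranslate_left`; **`exists_comp_kerι_eq_iff_forall_mem`** — `(∃ s, s ≫ ι = t) ↔ ∀ a ∈ 𝔭, t ≫ act.i a = 1` for EVERY
  `T : Over S` (the dock clause `hkerG₀` VERBATIM over the base); `exists_comp_kerι_eq_iff_forall` (generators), `kerι_comp_i_eq_one`.
* §2 `ker_hom_eq_snd_left`, **`isFinite_ker_hom`**, **`flat_ker_hom`**, `isAffine_ker_left` (quasi-inverse hypotheses; ★ `isFinite∕flat_serreTranslate_left`
  along ★ `isPullback_kerι_left`).
* §3 **`exists_baseChange_iso`** — `(Over.pullback g).obj 𝒢 ≅ ker (serreTranslate (act.baseChange g) E′ hE′ P)` commuting with the inclusions (★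
  `GroupSchemeKernel.baseChangeIso` + ★ `serreTranslateBC_eq` + ★ `kerIsoOfCompEqOneIff`); with §1 for `A.baseChange g` the clause holds on every fibre.
* §4 **`exists_iso_of_forall_iff`** — UNIQUENESS: any monomorphism `ι′ : G′ ⟶ A` with the kernel-of-`𝔭` clause is isomorphic to `ι` over `A` (so the
  dock՚s `G₀ x̄` IS `A[𝔭]_κ̄` at `x̄` and `A_K[𝔭]` IS `A[𝔭]_K`, canonically, no rank comparison); `isMonHom_of_comp_kerι_eq`.
RANK: `𝒢 → S` finite flat of finite presentation ⇒ locally free of locally constant rank; the value (`q²` at the dock, `#A_K[𝔭](K̄)` upstairs) is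
read from either fibre — not recomputed here.

## References
* [Conrad2004GrossZagier] B. Conrad, *Gross–Zagier revisited*, MSRI Publ. 49 (2004), §7 «The Serre tensor construction», Thm. 7.5.
* [MilneCM2006] J. S. Milne, *Complex Multiplication* (2006), §7 «𝔞-multiplications».
* [GortzWedhorn2020] U. Görtz, T. Wedhorn, *Algebraic Geometry I*, 2nd ed. (2020), (4.15) (p. 116), Definition 4.45 (2) (p. 117).
* [GortzWedhorn2023] U. Görtz, T. Wedhorn, *Algebraic Geometry II* (2023), Cor. 27.177 (1).
* [MumfordFogartyKirwan1994] D. Mumford, J. Fogarty, F. Kirwan, *GIT*, 3rd ed. (1994), Ch. 6 §2 Lemma 6.12 (p. 122).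
-/

noncomputable section

universe u

open CategoryTheory CategoryTheory.Limits AlgebraicGeometry MonoidalCategory CartesianMonoidalCategory
open scoped MonObj CategoryTheory.Obj
open Literature.AlgebraicGeometry.GroupSchemes Literature.AlgebraicGeometry.GroupSchemes.GroupSchemeKernel

namespace Literature.AlgebraicGeometry.AbelianSchemes

namespace AbelianSchemeOver

namespace IdealTorsion

variable {S : Scheme.{u}} {A : AbelianSchemeOver S} {O : Type*} [CommRing O] (act : A.RingAction O) [IsCommMonObj A.X]
  {m : ℕ} (E' : Matrix (Fin m) (Fin m) O) (hE' : E' * E' = E') (P : Matrix (Fin m) (Fin 1) O)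

/-! ## §1 `A[𝔭] := Ker ψ_P` is a closed subgroup scheme with the kernel-of-`𝔭` universal property on ALL `T`-points -/

/-- **THE `𝔭`-TORSION SUBGROUP SCHEME `A[𝔭] := Ker ψ_P ↪ A` IS A CLOSED IMMERSION** (`A → S` is separated, so the unit section of
`A ⊗_𝒪 𝔟` is closed and kernels are closed, ★ `isClosedImmersion_kerι_left_of_isSeparated`). [cite: GortzWedhorn2020, Definition 4.45 (2), p. 117]
[cite: Conrad2004GrossZagier, §7 (Thm. 7.5)] -/
theorem isClosedImmersion_kerι_serreTranslate_left :
    IsClosedImmersion (kerι (serreTranslate act E' hE' P)).left := by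
  haveI := (serreTensor act E' hE').isProper
  haveI : IsSeparated (serreTensor act E' hE').X.hom := inferInstance
  exact isClosedImmersion_kerι_left_of_isSeparated _

/-- **`A[𝔭](T) = {t ∈ A(T) | ι(a) t = 1 ∀ a ∈ 𝔭}` FOR EVERY `S`-SCHEME `T`** — the kernel-of-`𝔭` universal property of
`ι : A[𝔭] := Ker ψ_P ↪ A` (the D-line dock clause `hkerG₀`, over the base): a `T`-point `t` of `A` factors through `ι` iff it is killed by
every `ι(a)`, `a ∈ 𝔭 = (P_1, …, P_m)` (★ `kerLift` ∕ `kerι_comp` + ★ `comp_serreTranslate_eq_one_iff_forall_mem`).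
[cite: Conrad2004GrossZagier, §7 (Thm. 7.5)] [cite: MilneCM2006, §7] [cite: GortzWedhorn2020, Definition 4.45 (2), p. 117] -/
theorem exists_comp_kerι_eq_iff_forall_mem (hP : E' * P = P) {𝔭 : Ideal O} (h𝔭 : Ideal.span (Set.range fun k => P k 0) = 𝔭)
    {T : Over S} (t : T ⟶ A.X) :
    (∃ s : T ⟶ ker (serreTranslate act E' hE' P), s ≫ kerι (serreTranslate act E' hE' P) = t) ↔ ∀ a ∈ 𝔭, t ≫ act.i a = 1 := by
  rw [← comp_serreTranslate_eq_one_iff_forall_mem act E' hE' P hP h𝔭 t]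
  constructor
  · rintro ⟨s, rfl⟩
    rw [Category.assoc, kerι_comp, MonObj.comp_one]  -- hmm `s ≫ 1 = 1`
  · intro ht
    exact ⟨kerLift t ht, kerLift_ι t ht⟩

/-- The generators suffice: `t` factors through `A[𝔭]` iff `ι(P_k) t = 1` for all `k`. [cite: Conrad2004GrossZagier, §7 (Thm. 7.5)] -/
theorem exists_comp_kerι_eq_iff_forall (hP : E' * P = P) {T : Over S} (t : T ⟶ A.X) :
    (∃ s : T ⟶ ker (serreTranslate act E' hE' P), s ≫ kerι (serreTranslate act E' hE' P) = t) ↔ ∀ k, t ≫ act.i (P k 0) = 1 := by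
  rw [← comp_serreTranslate_eq_one_iff act E' hE' P hP t]
  constructor
  · rintro ⟨s, rfl⟩
    rw [Category.assoc, kerι_comp, MonObj.comp_one]
  · intro ht
    exact ⟨kerLift t ht, kerLift_ι t ht⟩

/-- `A[𝔭] ↪ A` is killed by every `a ∈ 𝔭`: `ι ≫ ι_A(a) = 1`. [cite: MilneCM2006, §7] -/
theorem kerι_comp_i_eq_one (hP : E' * P = P) {𝔭 : Ideal O} (h𝔭 : Ideal.span (Set.range fun k => P k 0) = 𝔭) {a : O} (ha : a ∈ 𝔭) :
    kerι (serreTranslate act E' hE' P) ≫ act.i a = 1 :=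
  (exists_comp_kerι_eq_iff_forall_mem act E' hE' P hP h𝔭 _).1 ⟨𝟙 _, Category.id_comp _⟩ a ha

/-! ## §2 `A[𝔭] → S` is finite, flat, affine-over-`S` (quasi-inverse `Q`, `N ≠ 0`) -/

section Finite

variable (Q : Matrix (Fin 1) (Fin m) O) {N : ℕ}

/-- The structure morphism of `Ker ψ = A ×_{ψ, A ⊗ 𝔟, e} 𝟙` is the second projection (on underlying schemes). [cite: GortzWedhorn2020, Definition 4.45 (2)] -/
theorem ker_hom_eq_snd_left : (ker (serreTranslate act E' hE' P)).hom =
    (pullback.snd (serreTranslate act E' hE' P) (η[(serreTensor act E' hE').X] : 𝟙_ _ ⟶ _)).left := by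
  have h := Over.w (pullback.snd (serreTranslate act E' hE' P) (η[(serreTensor act E' hE').X] : 𝟙_ _ ⟶ _))
  exact h.symm.trans (Category.comp_id _)

/-- **`A[𝔭] → S` IS FINITE** (base change of the finite `ψ_P`, ★ `isFinite_serreTranslate_left`, along the unit section, ★ `isPullback_kerι_left`).
[cite: Conrad2004GrossZagier, §7 (Thm. 7.5)] [cite: GortzWedhorn2023, Cor. 27.177 (1)] -/
theorem isFinite_ker_hom (hN : N ≠ 0) (hP : E' * P = P) (hQ : Q * E' = Q)
    (hQP : Q * P = Matrix.scalar (Fin 1) (N : O)) (hPQ : P * Q = Matrix.scalar (Fin m) (N : O) * E') :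
    IsFinite (ker (serreTranslate act E' hE' P)).hom := by
  haveI := isFinite_serreTranslate_left act E' hE' P Q hN hP hQ hQP hPQ
  rw [ker_hom_eq_snd_left]
  exact MorphismProperty.of_isPullback (isPullback_kerι_left (serreTranslate act E' hE' P)) inferInstance

/-- **`A[𝔭] → S` IS FLAT** (base change of the flat `ψ_P`, ★ `flat_serreTranslate_left`). [cite: Conrad2004GrossZagier, §7 (Thm. 7.5)]
[cite: MumfordFogartyKirwan1994, Ch. 6 §2 Lemma 6.12 (p. 122)] -/
theorem flat_ker_hom (hN : N ≠ 0) (hP : E' * P = P) (hQ : Q * E' = Q)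
    (hQP : Q * P = Matrix.scalar (Fin 1) (N : O)) (hPQ : P * Q = Matrix.scalar (Fin m) (N : O) * E') :
    Flat (ker (serreTranslate act E' hE' P)).hom := by
  haveI := flat_serreTranslate_left act E' hE' P Q hN hP hQ hQP hPQ
  rw [ker_hom_eq_snd_left]
  exact MorphismProperty.of_isPullback (isPullback_kerι_left (serreTranslate act E' hE' P)) inferInstance

/-- `A[𝔭]` is an affine scheme when `S` is affine (finite over affine; Mathlib `isAffine_of_isAffineHom`).
[cite: GortzWedhorn2023, Cor. 27.177 (1)] -/
theorem isAffine_ker_left [IsAffine S] (hN : N ≠ 0) (hP : E' * P = P) (hQ : Q * E' = Q)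
    (hQP : Q * P = Matrix.scalar (Fin 1) (N : O)) (hPQ : P * Q = Matrix.scalar (Fin m) (N : O) * E') :
    IsAffine (ker (serreTranslate act E' hE' P)).left := by
  haveI := isFinite_ker_hom act E' hE' P Q hN hP hQ hQP hPQ
  exact isAffine_of_isAffineHom (ker (serreTranslate act E' hE' P)).hom

end Finite

/-! ## §3 Base change: `A[𝔭] ×_S S′ ≅ A_{S′}[𝔭]` over `A_{S′}` -/

section BaseChange

variable {S' : Scheme.{u}} (g : S' ⟶ S)

/-- **`A[𝔭]` COMMUTES WITH BASE CHANGE**: `(Ker ψ_P) ×_S S′ ≅ Ker ψ_P(A_{S′})` compatibly with the inclusions into `A_{S′}` — kernels commute with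
base change (★ `GroupSchemeKernel.baseChangeIso`) and `(ψ_P)_{S′} = ψ_P(A_{S′}) ≫ β⁻¹` for the isomorphism `β : (A ⊗ 𝔟)_{S′} ≅ A_{S′} ⊗ 𝔟` (★
`serreTranslateBC_eq`), so the two have the same kernel on points (★ `kerIsoOfCompEqOneIff`).  With §1 applied to `A_{S′}` this puts the kernel-of-`𝔭`
clause on EVERY base change (`S′ = Spec K`, `Spec κ̄`, …) of the SAME finite flat `A[𝔭]`. [cite: GortzWedhorn2020, (4.15), p. 116 and Definition 4.45 (2), p. 117]
[cite: Conrad2004GrossZagier, §7 (Thm. 7.5)] -/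
theorem exists_baseChange_iso (hP : E' * P = P) :
    ∃ e : (Over.pullback g).obj (ker (serreTranslate act E' hE' P)) ≅
        ker (@serreTranslate S' (A.baseChange g) O _ (act.baseChange g) (isCommMonObj_baseChange g) m E' hE' P),
      e.hom ≫ kerι _ = (Over.pullback g).map (kerι (serreTranslate act E' hE' P)) := by
  haveI := isCommMonObj_baseChange g (A := A)
  haveI hβ : IsMonHom (serreTensorBaseChangeIso' g act E' hE').hom := (isMonHom_serreTensorBaseChangeIso g act E' hE').1
  have hbc : serreTranslateBC g act P E' hE' =
      @serreTranslate S' (A.baseChange g) O _ (act.baseChange g) (isCommMonObj_baseChange g) m E' hE' P ≫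
        (serreTensorBaseChangeIso' g act E' hE').inv := serreTranslateBC_eq g act P E' hE' hP
  -- same kernel on points
  have h : ∀ {T : Over S'} (t : T ⟶ (A.baseChange g).X),
      t ≫ serreTranslateBC g act P E' hE' = 1 ↔
        t ≫ @serreTranslate S' (A.baseChange g) O _ (act.baseChange g) (isCommMonObj_baseChange g) m E' hE' P = 1 := by
    intro T t
    have key : t ≫ @serreTranslate S' (A.baseChange g) O _ (act.baseChange g) (isCommMonObj_baseChange g) m E' hE' P =
        (t ≫ serreTranslateBC g act P E' hE') ≫ (serreTensorBaseChangeIso' g act E' hE').hom := by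
      rw [hbc, Category.assoc, Category.assoc, Iso.inv_hom_id, Category.comp_id]
    constructor
    · intro h1
      rw [key, h1, MonObj.one_comp]
    · intro h1
      have key' : t ≫ serreTranslateBC g act P E' hE' =
          (t ≫ @serreTranslate S' (A.baseChange g) O _ (act.baseChange g) (isCommMonObj_baseChange g) m E' hE' P) ≫
            (serreTensorBaseChangeIso' g act E' hE').inv := by
        rw [hbc, Category.assoc]
      haveI : IsMonHom (serreTensorBaseChangeIso' g act E' hE').inv := (isMonHom_serreTensorBaseChangeIso g act E' hE').2
      rw [key', h1, MonObj.one_comp]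
  let e₁ : (Over.pullback g).obj (ker (serreTranslate act E' hE' P)) ≅ ker (serreTranslateBC g act P E' hE') :=
    GroupSchemeKernel.baseChangeIso g (serreTranslate act E' hE' P)
  let e₂ := kerIsoOfCompEqOneIff (serreTranslateBC g act P E' hE')
    (@serreTranslate S' (A.baseChange g) O _ (act.baseChange g) (isCommMonObj_baseChange g) m E' hE' P) h
  refine ⟨e₁ ≪≫ e₂, ?_⟩
  rw [Iso.trans_hom, Category.assoc, kerIsoOfCompEqOneIff_hom_ι]
  exact GroupSchemeKernel.baseChangeIso_hom_comp_kerι g (serreTranslate act E' hE' P)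

end BaseChange

/-! ## §4 Uniqueness of the realisation: any closed subgroup with the kernel-of-`𝔭` clause IS `A[𝔭]` -/

/-- **UNIQUENESS OF THE `𝔭`-TORSION LAYER**: if `ι′ : G′ ⟶ A` is a monomorphism with the kernel-of-`𝔭` clause on `T`-points (the dock՚s
`hkerG₀`), then `G′ ≅ A[𝔭] = Ker ψ_P` over `A` (each factors uniquely through the other).  So the dock՚s `G₀ x̄` at a special point and the
generic `A_K[𝔭]` ARE the fibres of `A[𝔭]`, canonically. [cite: GortzWedhorn2020, Definition 4.45 (2), p. 117] [cite: MilneCM2006, §7] -/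
theorem exists_iso_of_forall_iff (hP : E' * P = P) {𝔭 : Ideal O} (h𝔭 : Ideal.span (Set.range fun k => P k 0) = 𝔭)
    {G' : Over S} (ι' : G' ⟶ A.X) [Mono ι']
    (hG' : ∀ ⦃T : Over S⦄ (t : T ⟶ A.X), (∃ s : T ⟶ G', s ≫ ι' = t) ↔ ∀ a ∈ 𝔭, t ≫ act.i a = 1) :
    ∃ e : G' ≅ ker (serreTranslate act E' hE' P), e.hom ≫ kerι (serreTranslate act E' hE' P) = ι' := by
  -- `ι'` is killed by `𝔭`, so it lifts to the kernel; `kerι` is killed by `𝔭`, so it lifts to `G'`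
  have h1 : ∀ a ∈ 𝔭, ι' ≫ act.i a = 1 := (hG' ι').1 ⟨𝟙 _, Category.id_comp _⟩
  obtain ⟨u, hu⟩ := (exists_comp_kerι_eq_iff_forall_mem act E' hE' P hP h𝔭 ι').2 h1
  obtain ⟨v, hv⟩ := (hG' (kerι (serreTranslate act E' hE' P))).2 (fun a ha => kerι_comp_i_eq_one act E' hE' P hP h𝔭 ha)
  refine ⟨⟨u, v, ?_, ?_⟩, hu⟩
  · rw [← cancel_mono ι', Category.assoc, hv, hu, Category.id_comp]
  · apply ker_hom_ext
    rw [Category.assoc, hu, hv, Category.id_comp]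

/-- With both inclusions homomorphisms, ANY comparison map over `A` into `A[𝔭]` is a homomorphism: it is the kernel lift of `ι′`
(★ `ker_hom_ext`, ★ `isMonHom_kerLift`). [cite: GortzWedhorn2020, Definition 4.45 (2), p. 117] -/
theorem isMonHom_of_comp_kerι_eq (hP : E' * P = P) {𝔭 : Ideal O} (h𝔭 : Ideal.span (Set.range fun k => P k 0) = 𝔭)
    {G' : Over S} [GrpObj G'] (ι' : G' ⟶ A.X) [IsMonHom ι']
    (hι' : ∀ a ∈ 𝔭, ι' ≫ act.i a = 1)
    (e : G' ⟶ ker (serreTranslate act E' hE' P)) (he : e ≫ kerι (serreTranslate act E' hE' P) = ι') :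
    haveI := isMonHom_serreTranslate act E' hE' P; IsMonHom e := by
  haveI := isMonHom_serreTranslate act E' hE' P
  have hk : ι' ≫ serreTranslate act E' hE' P = 1 := comp_serreTranslate_eq_one_of_forall_mem act E' hE' P hP h𝔭 ι' hι'
  have heq : e = kerLift ι' hk := ker_hom_ext (by rw [he, kerLift_ι])
  rw [heq]
  exact isMonHom_kerLift ι' hk

end IdealTorsion

end AbelianSchemeOver

end Literature.AlgebraicGeometry.AbelianSchemes

end
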